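import Literature.Algebra.Polynomial.CasasAlvero.Induction
import Literature.Algebra.Polynomial.CasasAlvero.Descent
import Mathlib.Algebra.Polynomial.Taylor
import Mathlib.Tactic.LinearCombination
import HarnessLib

/-!
# Casas-Alvero in degree 4 (elementary, away from characteristics 2, 3, 5, 7) and translation invariance

* `hasseDeriv_taylor`, `SharesRoot.taylor`, `IsCasasAlvero.taylor` — the Casas-Alvero property is invariant under
  the Taylor shift `f ↦ f(X + r)` (Hasse derivatives commute with it).
* `holdsInDegree_four` — over a field in which `210 = 2·3·5·7 ≠ 0`, a monic Casas-Alvero quartic is `(X - a)^4`.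
  Elementary: shift so that the `X^3`-coefficient vanishes (uses `2 ≠ 0`); the root shared with `D^{(3)} f = 4X`
  is `0`, so the constant term vanishes; writing `f = X^4 + bX^2 + cX`, the roots `θ₂`, `θ₁` shared with
  `D^{(2)} f = 6X^2 + b` and `D^{(1)} f = 4X^3 + 2bX + c` force `b = c = 0` through the identities
  `θ₂ (c - 5θ₂^3) = 0`, `3θ₂^2 (4θ₁ - 5θ₂) = 0` and `35 θ₂^3 = 0` (whence the exceptional primes `3, 5, 7`).
  The primes `2, 3, 5, 7` are exactly the "bad primes" of degree `4` listed by Graf von Bothmer–Labs–Schicho–van de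
  Woestijne; in characteristic `2` the statement still holds over perfect fields (`4 = 2^2`, `holdsInDegree_prime_pow`).
* `holdsInDegree_four_mul_prime_pow_field` — consequently, over every field of characteristic `p ≥ 11`, Casas-Alvero
  holds in degree `4 · p^k` (GvBLSW Prop. 6 + descent).

Reference: H.-C. Graf von Bothmer, O. Labs, J. Schicho, C. van de Woestijne, *The Casas-Alvero conjecture for
infinitely many degrees*, J. Algebra 316 (2007) 224–230, arXiv:math/0605090 (Prop. 6 and the table of bad primes, §3).
-/

noncomputable section

open Polynomial

namespace Literature.Algebra.Polynomial.CasasAlvero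

section Taylor

variable {R : Type*} [CommRing R]

/-- Hasse derivatives commute with the Taylor shift `f ↦ f(X + r)`. [folklore] -/
theorem hasseDeriv_taylor (r : R) (f : R[X]) (k : ℕ) :
    hasseDeriv k (taylor r f) = taylor r (hasseDeriv k f) := by
  ext n
  have hc := congrArg (fun φ : R[X] →ₗ[R] R[X] => φ f) (hasseDeriv_comp (R := R) n k)
  simp only [LinearMap.comp_apply, LinearMap.smul_apply] at hc
  rw [hasseDeriv_coeff, taylor_coeff, taylor_coeff, hc, eval_smul, nsmul_eq_mul, Nat.choose_symm_add]

/-- A shared root survives the Taylor shift. [folklore] -/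
theorem SharesRoot.taylor (r : R) {f g : R[X]} (h : SharesRoot f g) :
    SharesRoot (taylor r f) (taylor r g) := by
  obtain ⟨θ, hf, hg⟩ := h
  exact ⟨θ - r, by rw [taylor_eval, sub_add_cancel, hf], by rw [taylor_eval, sub_add_cancel, hg]⟩

/-- The Casas-Alvero property is invariant under the Taylor shift `f ↦ f(X + r)`. [folklore] -/
theorem IsCasasAlvero.taylor (r : R) {f : R[X]} (h : IsCasasAlvero f) : IsCasasAlvero (taylor r f) := by
  intro i hi0 hi
  rw [natDegree_taylor] at hi
  rw [hasseDeriv_taylor]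
  exact (h i hi0 hi).taylor r

end Taylor

section Four

variable {K : Type*} [Field K]

/-- Evaluation of the Hasse derivatives of a depressed monic quartic `X^4 + bX^2 + cX + e`. [folklore] -/
theorem eval_hasseDeriv_of_quartic {g : K[X]} (hd : g.natDegree = 4) (h4 : g.coeff 4 = 1) (h3 : g.coeff 3 = 0)
    (θ : K) :
    (hasseDeriv 1 g).eval θ = 4 * θ ^ 3 + 2 * g.coeff 2 * θ + g.coeff 1 ∧
    (hasseDeriv 2 g).eval θ = 6 * θ ^ 2 + g.coeff 2 ∧
    (hasseDeriv 3 g).eval θ = 4 * θ := by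
  have h5 : ∀ j, 4 < j → g.coeff j = 0 := fun j hj => coeff_eq_zero_of_natDegree_lt (by omega)
  have hlt : ∀ k, 0 < k → (hasseDeriv k g).natDegree < 4 := fun k hk =>
    lt_of_le_of_lt (natDegree_hasseDeriv_le g k) (by omega)
  refine ⟨?_, ?_, ?_⟩ <;>
  · rw [eval_eq_sum_range' (hlt _ (by norm_num))]
    simp only [Finset.sum_range_succ, Finset.sum_range_zero, hasseDeriv_coeff, h3, h4, h5 5 (by norm_num),
      h5 6 (by norm_num)]
    norm_num [Nat.choose]
    try ring

/-- A depressed (`[X^3] g = 0`) monic Casas-Alvero quartic over a field with `210 ≠ 0` is `X^4`. [folklore] -/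
theorem eq_X_pow_four_of_depressed {g : K[X]} (h210 : (210 : K) ≠ 0) (hg : g.Monic) (hd : g.natDegree = 4)
    (hca : IsCasasAlvero g) (h3 : g.coeff 3 = 0) : g = X ^ 4 := by
  have h4 : g.coeff 4 = 1 := by simpa [hd] using hg.coeff_natDegree
  have K2 : (2 : K) ≠ 0 := fun h => h210 (by linear_combination (105 : K) * h)
  have K3 : (3 : K) ≠ 0 := fun h => h210 (by linear_combination (70 : K) * h)
  have K4 : (4 : K) ≠ 0 := by convert mul_ne_zero K2 K2 using 1; norm_num
  have K5 : (5 : K) ≠ 0 := fun h => h210 (by linear_combination (42 : K) * h)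
  have K35 : (35 : K) ≠ 0 := fun h => h210 (by linear_combination (6 : K) * h)
  set b := g.coeff 2 with hb
  set c := g.coeff 1 with hc
  set e := g.coeff 0 with he
  -- the polynomial and its values
  have hgsum : g = X ^ 4 + C b * X ^ 2 + C c * X + C e := by
    conv_lhs => rw [g.as_sum_range_C_mul_X_pow, hd]
    simp only [Finset.sum_range_succ, Finset.sum_range_zero, h3, h4, map_one, one_mul, map_zero, zero_mul,
      add_zero, zero_add, pow_zero, mul_one, pow_one]
    ring
  have hev : ∀ θ, g.eval θ = θ ^ 4 + b * θ ^ 2 + c * θ + e := by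
    intro θ; rw [hgsum]; simp
  -- the three shared roots
  have hd' : g.natDegree = 4 := hd
  obtain ⟨θ₁, G1, A1⟩ := hca 1 one_pos (by omega)
  obtain ⟨θ₂, G2, A2⟩ := hca 2 two_pos (by omega)
  obtain ⟨θ₃, G3, A3⟩ := hca 3 three_pos (by omega)
  rw [hev] at G1 G2 G3
  rw [(eval_hasseDeriv_of_quartic hd h4 h3 _).1] at A1
  rw [(eval_hasseDeriv_of_quartic hd h4 h3 _).2.1] at A2
  rw [(eval_hasseDeriv_of_quartic hd h4 h3 _).2.2] at A3
  -- e = 0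
  have hθ₃ : θ₃ = 0 := (mul_eq_zero.mp A3).resolve_left K4
  have he0 : e = 0 := by rw [hθ₃] at G3; simpa using G3
  -- b = c = 0
  have hbc : b = 0 ∧ c = 0 := by
    have split₂ : θ₂ * (c - 5 * θ₂ ^ 3) = 0 := by linear_combination G2 - θ₂ ^ 2 * A2 - he0
    rcases mul_eq_zero.mp split₂ with hθ₂ | hc5
    · have hb0 : b = 0 := by linear_combination A2 - 6 * θ₂ * hθ₂
      have split₁ : θ₁ * (θ₁ ^ 3 + c) = 0 := by linear_combination G1 - θ₁ ^ 2 * hb0 - he0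
      rcases mul_eq_zero.mp split₁ with hθ₁ | hq
      · exact ⟨hb0, by linear_combination A1 - (4 * θ₁ ^ 2) * hθ₁ - 2 * θ₁ * hb0⟩
      · have : (3 : K) * c = 0 := by linear_combination 4 * hq - A1 + 2 * θ₁ * hb0
        exact ⟨hb0, (mul_eq_zero.mp this).resolve_left K3⟩
    · have hb6 : b = -6 * θ₂ ^ 2 := by linear_combination A2
      have hc5' : c = 5 * θ₂ ^ 3 := by linear_combination hc5
      have split₁ : θ₁ * (θ₁ ^ 3 - 6 * θ₂ ^ 2 * θ₁ + 5 * θ₂ ^ 3) = 0 := by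
        linear_combination G1 - θ₁ ^ 2 * hb6 - θ₁ * hc5' - he0
      have A1' : 4 * θ₁ ^ 3 - 12 * θ₂ ^ 2 * θ₁ + 5 * θ₂ ^ 3 = 0 := by
        linear_combination A1 - 2 * θ₁ * hb6 - hc5'
      suffices hθ₂ : θ₂ = 0 by
        constructor
        · rw [hb6, hθ₂]; ring
        · rw [hc5', hθ₂]; ring
      rcases mul_eq_zero.mp split₁ with hθ₁ | B1
      · have : (5 : K) * θ₂ ^ 3 = 0 := by linear_combination A1' - (4 * θ₁ ^ 2 - 12 * θ₂ ^ 2) * hθ₁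
        exact pow_eq_zero_iff (by norm_num) |>.mp ((mul_eq_zero.mp this).resolve_left K5)
      · have L3 : 3 * θ₂ ^ 2 * (4 * θ₁ - 5 * θ₂) = 0 := by linear_combination A1' - 4 * B1
        rcases mul_eq_zero.mp L3 with hθ₂ | L
        · exact pow_eq_zero_iff (by norm_num) |>.mp ((mul_eq_zero.mp hθ₂).resolve_left K3)
        · have : (35 : K) * θ₂ ^ 3 = 0 := by
            linear_combination (-64) * B1 + (16 * θ₁ ^ 2 + 20 * θ₁ * θ₂ - 71 * θ₂ ^ 2) * L
          exact pow_eq_zero_iff (by norm_num) |>.mp ((mul_eq_zero.mp this).resolve_left K35)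
  rw [hgsum, hbc.1, hbc.2, he0]; simp

/-- **Casas-Alvero in degree 4**, elementary: over a field in which `210 = 2·3·5·7 ≠ 0` (i.e. of characteristic
`∉ {2, 3, 5, 7}`), a monic Casas-Alvero quartic is `(X - a)^4`. [folklore] -/
theorem holdsInDegree_four (h210 : (210 : K) ≠ 0) : HoldsInDegree K 4 := by
  have K2 : (2 : K) ≠ 0 := fun h => h210 (by linear_combination (105 : K) * h)
  have K4 : (4 : K) ≠ 0 := by convert mul_ne_zero K2 K2 using 1; norm_num
  intro f hf hd hca
  set r : K := -(f.coeff 3 / 4) with hr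
  have hmon : (taylor r f).Monic := by rw [Monic, leadingCoeff_taylor]; exact hf
  have hdeg : (taylor r f).natDegree = 4 := by rw [natDegree_taylor, hd]
  have h3 : (taylor r f).coeff 3 = 0 := by
    have hf4 : f.coeff 4 = 1 := by simpa [hd] using hf.coeff_natDegree
    have hlt : (hasseDeriv 3 f).natDegree < 2 :=
      lt_of_le_of_lt (natDegree_hasseDeriv_le f 3) (by omega)
    rw [taylor_coeff, eval_eq_sum_range' hlt]
    simp only [Finset.sum_range_succ, Finset.sum_range_zero, hasseDeriv_coeff, hf4]
    norm_num [Nat.choose]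
    rw [hr]; field_simp; ring
  have hg := eq_X_pow_four_of_depressed h210 hmon hdeg (hca.taylor r) h3
  refine ⟨r, ?_⟩
  have hback : f = taylor (-r) (taylor r f) := by rw [taylor_taylor, neg_add_cancel, taylor_zero]
  rw [hback, hg, taylor_X_pow, map_neg, ← sub_eq_add_neg]

/-- Over every field of characteristic `p ≥ 11`, Casas-Alvero holds in degree `4 · p^k`: degree `4` is elementary
over the algebraic closure (`holdsInDegree_four`), then GvBLSW Prop. 6 (`holdsInDegree_mul_prime_pow`) and descent
(`HoldsInDegree.descend`). [cite: GrafVonBothmerEtAl2007, Prop. 6] -/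
theorem holdsInDegree_four_mul_prime_pow_field (K : Type*) [Field K] (p : ℕ) [Fact p.Prime] [CharP K p]
    (hp11 : 11 ≤ p) (k : ℕ) : HoldsInDegree K (4 * p ^ k) := by
  refine HoldsInDegree.descend (algebraMap K (AlgebraicClosure K)) (holdsInDegree_mul_prime_pow p ?_ k)
  refine holdsInDegree_four ?_
  -- 210 ≠ 0 in characteristic p ≥ 11
  intro h
  have h' : ((210 : ℕ) : AlgebraicClosure K) = 0 := by exact_mod_cast h
  rw [CharP.cast_eq_zero_iff (AlgebraicClosure K) p] at h'
  have hp : p.Prime := Fact.out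
  have : p ∣ 2 * 3 * 5 * 7 := by simpa using h'
  rcases (Nat.Prime.dvd_mul hp).mp this with h1 | h7
  · rcases (Nat.Prime.dvd_mul hp).mp h1 with h2 | h5
    · rcases (Nat.Prime.dvd_mul hp).mp h2 with h2 | h3
      · have := Nat.le_of_dvd (by norm_num) h2; omega
      · have := Nat.le_of_dvd (by norm_num) h3; omega
    · have := Nat.le_of_dvd (by norm_num) h5; omega
  · have := Nat.le_of_dvd (by norm_num) h7; omega

end Four

end Literature.Algebra.Polynomial.CasasAlvero
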